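import Summits.AtomisticToContinuum.Crystallization.Theorems.ExcessDecayLiouvilleSiteGeometry

/-!
# Route `ExcessDecayLiouville`: Giaquinta's iteration (absorption) lemma

Ingredient (GI) of the energy route for item `ExcessDecay` (stmt-AtomisticToContinuum-9334; item evidence
`ExcessDecay-proof-architecture-v4.md`, F3): the elementary real-analysis lemma that absorbs a small multiple of the
estimated quantity at a larger radius (Giaquinta, *Multiple integrals in the calculus of variations*, Lemma V.3.1,
with exponent `2`).  If `Z` is nonnegative and bounded on `[a, b]` and

`Z s ≤ θ · Z t + A/(t − s)² + B`  for all `a ≤ s < t ≤ b`, with `0 ≤ θ < 1`, `A, B ≥ 0`,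

then `Z s ≤ 16/(1−θ)⁴ · (A/(t − s)² + B)` for all `a ≤ s < t ≤ b` (`giaquinta_iteration`).  Proof: iterate along
`s_i = t − τ^i (t − s)` with `τ = (1+θ)/2` (so that `θ < τ²`) and sum the two geometric series.
All `[folklore]`; helper lemmas, nothing here closes an item.
-/

noncomputable section

namespace Summit.AtomisticToContinuum.Crystallization.Theorems.ExcessDecayLiouville

open scoped BigOperators Topology

/-- The finite iteration behind Giaquinta's lemma: along `s_i = t − τ^i (t − s)`,
`Z s ≤ θ^k Z(s_k) + Σ_{i<k} θ^i (A/((1−τ)² τ^{2i} (t−s)²) + B)`. [folklore] -/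
theorem giaquinta_step {Z : ℝ → ℝ} {a b θ A B : ℝ} (hθ : 0 ≤ θ)
    (h : ∀ s t : ℝ, a ≤ s → s < t → t ≤ b → Z s ≤ θ * Z t + A / (t - s) ^ 2 + B)
    {τ : ℝ} (hτ0 : 0 < τ) (hτ1 : τ < 1) {s t : ℝ} (has : a ≤ s) (hst : s < t) (htb : t ≤ b) (k : ℕ) :
    Z s ≤ θ ^ k * Z (t - τ ^ k * (t - s)) +
      ∑ i ∈ Finset.range k, θ ^ i * (A / ((1 - τ) ^ 2 * τ ^ (2 * i) * (t - s) ^ 2) + B) := by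
  induction k with
  | zero => simp
  | succ k ih =>
    -- apply the hypothesis at the pair (s_k, s_{k+1})
    have hts : 0 < t - s := sub_pos.2 hst
    have hτk : 0 < τ ^ k := pow_pos hτ0 k
    have hsk_ge : a ≤ t - τ ^ k * (t - s) := by
      have : τ ^ k * (t - s) ≤ 1 * (t - s) :=
        mul_le_mul_of_nonneg_right (pow_le_one₀ hτ0.le hτ1.le) hts.le
      linarith
    have hlt : t - τ ^ k * (t - s) < t - τ ^ (k + 1) * (t - s) := by
      have : τ ^ (k + 1) * (t - s) < τ ^ k * (t - s) := by
        rw [pow_succ]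
        have : τ ^ k * τ < τ ^ k * 1 := mul_lt_mul_of_pos_left hτ1 hτk
        nlinarith
      linarith
    have hle : t - τ ^ (k + 1) * (t - s) ≤ b := by
      have : 0 ≤ τ ^ (k + 1) * (t - s) := by positivity
      linarith
    have hk := h _ _ hsk_ge hlt hle
    have hgap : (t - τ ^ (k + 1) * (t - s)) - (t - τ ^ k * (t - s)) = (1 - τ) * τ ^ k * (t - s) := by ring
    rw [hgap] at hk
    have hθk : 0 ≤ θ ^ k := pow_nonneg hθ k
    have hmul := mul_le_mul_of_nonneg_left hk hθk
    rw [Finset.sum_range_succ]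
    have e1 : θ ^ k * (θ * Z (t - τ ^ (k + 1) * (t - s)) + A / ((1 - τ) * τ ^ k * (t - s)) ^ 2 + B) =
        θ ^ (k + 1) * Z (t - τ ^ (k + 1) * (t - s)) +
          θ ^ k * (A / ((1 - τ) ^ 2 * τ ^ (2 * k) * (t - s) ^ 2) + B) := by
      rw [pow_succ, pow_mul]; ring
    rw [e1] at hmul
    linarith [ih, hmul]

/-- Partial geometric sums: `Σ_{i<k} q^i ≤ 1/(1−q)` for `0 ≤ q < 1`. [folklore] -/
theorem geom_partial_sum_le {q : ℝ} (hq0 : 0 ≤ q) (hq1 : q < 1) (k : ℕ) :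
    ∑ i ∈ Finset.range k, q ^ i ≤ 1 / (1 - q) := by
  have h1q : 0 < 1 - q := by linarith
  induction k with
  | zero => simp [h1q.le]
  | succ k ih =>
    rw [Finset.sum_range_succ', pow_zero]
    have : ∑ i ∈ Finset.range k, q ^ (i + 1) = q * ∑ i ∈ Finset.range k, q ^ i := by
      rw [Finset.mul_sum]
      exact Finset.sum_congr rfl fun i _ => by ring
    rw [this]
    have h2 : q * ∑ i ∈ Finset.range k, q ^ i ≤ q * (1 / (1 - q)) := mul_le_mul_of_nonneg_left ih hq0
    have h3 : q * (1 / (1 - q)) + 1 = 1 / (1 - q) := by field_simp; ring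
    linarith

/-- **Giaquinta's iteration lemma** (exponent `2`; see the module docstring). [folklore] -/
theorem giaquinta_iteration {Z : ℝ → ℝ} {a b θ A B M : ℝ} (hθ : 0 ≤ θ) (hθ1 : θ < 1) (hA : 0 ≤ A) (hB : 0 ≤ B)
    (hZM : ∀ ρ : ℝ, a ≤ ρ → ρ ≤ b → Z ρ ≤ M)
    (h : ∀ s t : ℝ, a ≤ s → s < t → t ≤ b → Z s ≤ θ * Z t + A / (t - s) ^ 2 + B)
    {s t : ℝ} (has : a ≤ s) (hst : s < t) (htb : t ≤ b) :
    Z s ≤ 16 / (1 - θ) ^ 4 * (A / (t - s) ^ 2 + B) := by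
  -- parameters
  obtain ⟨τ, hτ⟩ : ∃ τ : ℝ, τ = (1 + θ) / 2 := ⟨_, rfl⟩
  have hτ0 : 0 < τ := by rw [hτ]; linarith
  have hτ1 : τ < 1 := by rw [hτ]; linarith
  have h1θ : 0 < 1 - θ := by linarith
  have h1τ : 1 - τ = (1 - θ) / 2 := by rw [hτ]; ring
  obtain ⟨q, hq⟩ : ∃ q : ℝ, q = θ / τ ^ 2 := ⟨_, rfl⟩
  have hq_def : q = 4 * θ / (1 + θ) ^ 2 := by rw [hq, hτ]; field_simp; ring
  have hq0 : 0 ≤ q := by rw [hq]; positivity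
  have hq1 : q < 1 := by
    rw [hq_def, div_lt_one (by positivity)]
    nlinarith
  have h1q : 1 - q = (1 - θ) ^ 2 / (1 + θ) ^ 2 := by
    rw [hq_def]; field_simp; ring
  have hts : 0 < t - s := sub_pos.2 hst
  -- the bound for every k
  set K₀ : ℝ := A / ((1 - τ) ^ 2 * (t - s) ^ 2) * (1 / (1 - q)) + B * (1 / (1 - θ)) with hK₀
  have hstep : ∀ k : ℕ, Z s ≤ θ ^ k * M + K₀ := by
    intro k
    have hk := giaquinta_step hθ h hτ0 hτ1 has hst htb k
    have hsk_ge : a ≤ t - τ ^ k * (t - s) := by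
      have : τ ^ k * (t - s) ≤ 1 * (t - s) :=
        mul_le_mul_of_nonneg_right (pow_le_one₀ hτ0.le hτ1.le) hts.le
      linarith
    have hsk_le : t - τ ^ k * (t - s) ≤ b := by
      have : 0 ≤ τ ^ k * (t - s) := by positivity
      linarith
    have hZk := hZM _ hsk_ge hsk_le
    have h1 : θ ^ k * Z (t - τ ^ k * (t - s)) ≤ θ ^ k * M := mul_le_mul_of_nonneg_left hZk (pow_nonneg hθ k)
    have hsum : ∑ i ∈ Finset.range k, θ ^ i * (A / ((1 - τ) ^ 2 * τ ^ (2 * i) * (t - s) ^ 2) + B) =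
        A / ((1 - τ) ^ 2 * (t - s) ^ 2) * ∑ i ∈ Finset.range k, q ^ i + B * ∑ i ∈ Finset.range k, θ ^ i := by
      rw [Finset.mul_sum, Finset.mul_sum, ← Finset.sum_add_distrib]
      refine Finset.sum_congr rfl fun i _ => ?_
      rw [hq, div_pow, ← pow_mul]
      have hτi : τ ^ (2 * i) ≠ 0 := by positivity
      have h1τ0 : (1 - τ) ^ 2 ≠ 0 := by rw [h1τ]; positivity
      have hts0 : (t - s) ^ 2 ≠ 0 := by positivity
      field_simp
    have hg1 := geom_partial_sum_le hq0 hq1 k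
    have hg2 := geom_partial_sum_le hθ hθ1 k
    have hc1 : 0 ≤ A / ((1 - τ) ^ 2 * (t - s) ^ 2) := by positivity
    have h2 : ∑ i ∈ Finset.range k, θ ^ i * (A / ((1 - τ) ^ 2 * τ ^ (2 * i) * (t - s) ^ 2) + B) ≤ K₀ := by
      rw [hsum, hK₀]
      exact add_le_add (mul_le_mul_of_nonneg_left hg1 hc1) (mul_le_mul_of_nonneg_left hg2 hB)
    linarith [hk, h1, h2]
  -- let k → ∞
  have hZs : Z s ≤ K₀ := by
    by_contra hcon
    push Not at hcon
    rcases le_or_gt M 0 with hM | hM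
    · have := hstep 0
      simp only [pow_zero, one_mul] at this
      linarith
    · obtain ⟨k, hk⟩ := exists_pow_lt_of_lt_one (div_pos (sub_pos.2 hcon) hM) hθ1
      have := hstep k
      have h2 : θ ^ k * M < Z s - K₀ := by
        have := (lt_div_iff₀ hM).1 hk
        linarith
      linarith
  -- compare K₀ with the stated constant
  refine hZs.trans ?_
  have hcoefA : A / ((1 - τ) ^ 2 * (t - s) ^ 2) * (1 / (1 - q)) = 4 * (1 + θ) ^ 2 / (1 - θ) ^ 4 * (A / (t - s) ^ 2) := by
    rw [h1q, h1τ]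
    field_simp
    ring
  have hA' : 4 * (1 + θ) ^ 2 / (1 - θ) ^ 4 * (A / (t - s) ^ 2) ≤ 16 / (1 - θ) ^ 4 * (A / (t - s) ^ 2) := by
    refine mul_le_mul_of_nonneg_right ?_ (by positivity)
    rw [div_le_div_iff_of_pos_right (by positivity)]
    nlinarith
  have hB' : B * (1 / (1 - θ)) ≤ 16 / (1 - θ) ^ 4 * B := by
    rw [mul_comm]
    refine mul_le_mul_of_nonneg_right ?_ hB
    rw [div_le_div_iff₀ h1θ (by positivity)]
    have h3 : (1 - θ) ^ 4 ≤ 1 - θ := by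
      have : (1 - θ) ^ 3 ≤ 1 := pow_le_one₀ h1θ.le (by linarith)
      nlinarith
    nlinarith
  rw [hK₀, hcoefA]
  linarith

end Summit.AtomisticToContinuum.Crystallization.Theorems.ExcessDecayLiouville

end
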